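import Summits.PneNP.PneNP.Theses.SzkEntropy
import Summits.PneNP.PneNP.Theorems.PeaTwoMemBPP.Negative.NotPeaTwoMemBPPImpliesTarget
import Literature.Computability.Complexity.PolynomialEntropyApproximation
import Literature.Computability.Complexity.PromiseBPPClosureProofs

/-!
# Line `syndrome-equivocation` for crux `PeaTwoMemBPP` (stmt-PneNP-10778, route PneNP/SzkEntropy)

Skeleton (crux-plan, planner-cruxplan-stmt-PneNP-10778-syndrome-equivocatio-0, 2026-08-16) of the idea
card `Cruxes/PeaTwoMemBPP/Ideas/syndrome-equivocation.md` (ideator 2; triage r1: pass ×3), sharpened by the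
triage notes TRIAGE-r1-{1,2,3}.  Line card: `Lines/syndrome-equivocation.md`.

## The line in one paragraph

Every quadratic map is a linear image `q = G·m(x)` of the quadratic Veronese source; on the decoupled
sub-source `u ⊙ v = (u_j v_j)_j` (i.i.d. `Ber(1/4)` bits) the map `syndromeMap G : (u,v) ↦ G(u ⊙ v)` has
`H = H(G·Ber(1/4)^N) = N·h(1/4) − H_{ker G}(X | Y)`, the BSC(1/4) EQUIVOCATION of the binary linear code
`ker G`.  So `PEA₂` CONTAINS the coding rung `SyndromeEA` ("approximate the equivocation of an arbitrary
binary linear code at noise 1/4 to ±1/2 bit"); the line is: (K2, `stub_lift`) Karp-reduce `PEA₂` to that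
rung, and (K1) put the rung in promise-BPP by coding theory — light words of `C = rowsp G` / `K = ker G` by
information-set decoding, check-dense blocks by shortening at a random coordinate set, a one-sided
Parseval/Rényi census certificate (`stub_census`), and an inverse "no detectable structure ⇒ generic
formula `F₂ = E_e min(k, log₂ 1/P(e))`" theorem.  K1 is cut here by RATE REGIME (triage-2 sharpening (ii),
triage-1/2: "the critical ratio `k/N = h(1/4)` is K1's hardest test"): `stub_subcritical` (check density
`k/N ≤ r < h(1/4)`, resolvability side), `stub_supercritical` (`k/N ≥ r > h(1/4)`, reliable-decoding /
MAPDEC side), and `stub_critical` (deciders at every fixed distance from criticality ⇒ the whole rung: the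
UNIFORMITY claim across the critical window).  Each regime is closed under direct products of instances
(block-diagonal `G₁ ⊕ G₂`; densities combine as mediants), so by `PolyMapF2.entropy_prod` each membership
claim is equivalent to an additive `poly(N, 1/ε)` approximation SCHEME for `H(syndromeMap G)` on its regime
(Disproof.lean REMARK 6.2(i)).

## Composition (kernel-checked; no `sorry` outside the five stubs)

`PeaTwoMemBPP_of : PeaTwoMemBPP`, a `have`-chain of shape `stub_lift → stub_census → stub_subcritical →
stub_supercritical → stub_critical → PeaTwoMemBPP`, by
`PromiseProblem.mem_PromiseBPP'_of_polyTimeReducible_holds'` (Goldreich 2006 §1.2, PROVED in the tree) and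
`PeaTwoMemBPP ↔ PEA 2 ∈ PromiseBPP'` (`Iff.rfl`).

## Sorry-free by-products (provable now, proved here)

`syndromeMap_degLE` (the rung is degree 2), `syndromeEA_yes_le` / `syndromeEA_no_le` (sub-promise of
`PEA 2`), `mem_PromiseBPP'_anti`, and the NECESSITY embedding
`syndromeEA_of_peaTwoMemBPP : PeaTwoMemBPP → SyndromeEA R ∈ PromiseBPP'` for every rate predicate `R` — so the
conclusions of `stub_subcritical`, `stub_supercritical`, `stub_critical` are each NECESSARY for the crux: a
(conditional) refutation of any of them is a (conditional) refutation of `PeaTwoMemBPP` (card: "negative-side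
reading"; Disproof §3: that in turn proves thesis X).

## Disproof.lean used (cdisprove cycle 1–2, read 2026-08-16)

* §3: the crux has no hypothesis, so there is no `_false_without_` theorem to honour; instead
  `¬PeaTwoMemBPP → PeaThreeNotInP` — the necessity theorem above is this line's handle on that.
* §4/§4.7 (`census_does_not_determine_entropy`, `census_equivalent_gap_unbounded`, LANDED) and §5
  (`renyiFamily7`, LANDED): the census enters ONLY one-sidedly (`stub_census`: `H ≥ H₂ = k − log₂ W`), never as
  an estimate of `H` — no stub reads the census as determining `H`.
* §7 (LPN/syndrome regime: deficiency `≈ (1/2 ln 2) Σ_{c ∈ C∖0} 4^{-|c|}`, ISD finds the light dual words):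
  this is the sub-critical generic picture behind `stub_subcritical`.
* §8 (linearised-fibre estimator fails additively; any product-additive inexact estimator fails): the regime
  stubs are approximation SCHEMES (uniform in `1/ε`), not fixed-precision estimators.
* `DirectionalProfilesDoNotDetermineEntropy.lean` (cycle 2, LANDED): no stub uses directional-derivative
  rank profiles.

## Finding of this crux-plan (F*, details in the line card §Hardest stub)

Near-critical hidden block codes (disjoint random blocks of length `L = g·log N` at local check density
`h(1/4) ± Δ(g)`, `Δ → 0`) blind all three detectors of the card while moving `H` by `≈ N^{1/2}`: the card's
own "Cheapest falsifier" family exists on paper, so K1's FIXED-SCALE inverse theorem is false inside the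
critical window; weakly glued direct sums are however caught by a fourth polynomial detector (matroid
linking), and critically glued ones are detected by shortening but can only be RESOLVED by an approximation
scheme for worst-case short codes at precision `2^{-L/g}` — which is the crux's own FPRAS-type consequence.
Hence `stub_critical` is the hardest stub and the place where the crux most plausibly fails.
-/

set_option linter.dupNamespace false

namespace Summit.PneNP.PneNP.Cruxes.PeaTwoMemBPP.SyndromeEquivocation

open Literature.Computability.Complexity Literature.InformationTheory.Entropy
open Summit.PneNP.PneNP.Theses.SzkEntropy

/-! ### The coding rung inside `PEA 2` -/

/-- **Syndrome map of a parity-check matrix `G ∈ F₂^{k×N}`** as a sparse quadratic map on `2N` variables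
`(u, v)`: output `i` is `Σ_j G i j · u_j v_j` (monomial `[u_j, v_j]` listed iff `G i j = 1`).  On uniform
`(u, v)` the products `u_j v_j` are i.i.d. `Ber(1/4)`, so `H(syndromeMap G) = H(G·E)`, `E ∼ Ber(1/4)^N`,
`= N·h(1/4) − H(E | G E)` — the BSC(1/4) equivocation of the code `ker G` subtracted from the noise entropy.
[idea card syndrome-equivocation, Mechanism; DvirGutfreundRothblumVadhan2010 §2 for the presentation] -/
def syndromeMap {k N : ℕ} (G : Matrix (Fin k) (Fin N) (ZMod 2)) : PolyMapF2 (N + N) :=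
  (List.finRange k).map fun i =>
    ((List.finRange N).filter fun j => G i j = 1).map fun j => [Fin.castAdd N j, Fin.natAdd N j]

/-- Syndrome maps are quadratic (every monomial lists exactly two variables). [folklore] -/
theorem syndromeMap_degLE {k N : ℕ} (G : Matrix (Fin k) (Fin N) (ZMod 2)) : (syndromeMap G).DegLE 2 := by
  intro p hp μ hμ
  unfold syndromeMap at hp
  rw [List.mem_map] at hp
  obtain ⟨i, -, rfl⟩ := hp
  rw [List.mem_map] at hμ
  obtain ⟨j, -, rfl⟩ := hμ
  simp

/-- **`SyndromeEA R`: `PEA 2` restricted to SYNDROME INSTANCES with rate predicate `R`.**  An instance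
`(n, p, t)` of `PEA` is a syndrome instance iff it is literally `⟨N + N, (syndromeMap G, t)⟩` for some
`G ∈ F₂^{k×N}` with `R k N` (a constraint on the check density `k/N`; `fun _ _ => True` for none).  Same
encoding, same entropy functional, same integer thresholds with gap 1 (yes: `H ≥ t+1`, no: `H ≤ t`) as
`PEA 2`; the degree clause `DegLE 2` is kept verbatim (it holds automatically, `syndromeMap_degLE`) so that
the sub-promise inclusions are one-liners.  With `R = fun _ _ => True` this is the card's `SyndromeEA`:
"approximate the BSC(1/4) equivocation of an arbitrary binary linear code to ±1/2 bit"; the regime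
predicates used below are `fun k N => (k:ℚ) ≤ r·N` (density `≤ r`) and `fun k N => r·N ≤ (k:ℚ)` (density
`≥ r`). [idea card syndrome-equivocation, K1 and P1 (`SyndromeEA`)] -/
noncomputable def SyndromeEA (R : ℕ → ℕ → Prop) : PromiseProblem :=
  PromiseProblem.ofEncoding PEAInst.encoding
    {I | (∃ (k N : ℕ) (G : Matrix (Fin k) (Fin N) (ZMod 2)) (t : ℕ), R k N ∧ I = ⟨N + N, (syndromeMap G, t)⟩) ∧
      PolyMapF2.DegLE 2 I.2.1 ∧ (I.2.2 : ℝ) + 1 ≤ PolyMapF2.entropy I.2.1}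
    {I | (∃ (k N : ℕ) (G : Matrix (Fin k) (Fin N) (ZMod 2)) (t : ℕ), R k N ∧ I = ⟨N + N, (syndromeMap G, t)⟩) ∧
      PolyMapF2.DegLE 2 I.2.1 ∧ PolyMapF2.entropy I.2.1 ≤ (I.2.2 : ℝ)}

/-- `h(1/4) = 2 − (3/4)·log₂ 3 ≈ 0.8113`: the binary entropy of `1/4` in bits = entropy per coordinate of
`u_j v_j`; `k/N = h(1/4)` is the CRITICAL check density (the code `ker G` then has rate exactly the
BSC(1/4) capacity `1 − h(1/4) ≈ 0.189`). [CoverThomas2006, §2.1 and Thm 7.4.1 (BSC capacity)] -/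
noncomputable def hQuarter : ℝ := 2 - 3 / 4 * Real.logb 2 3

/-! ### Sub-promise and necessity (sorry-free) -/

/-- Yes-instances of the rung are yes-instances of `PEA 2`. [folklore] -/
theorem syndromeEA_yes_le (R : ℕ → ℕ → Prop) : (SyndromeEA R).yes ≤ (PEA 2).yes :=
  PEAInst.encoding.toLanguage_mono fun _ hI => ⟨hI.2.1, hI.2.2⟩

/-- No-instances of the rung are no-instances of `PEA 2`. [folklore] -/
theorem syndromeEA_no_le (R : ℕ → ℕ → Prop) : (SyndromeEA R).no ≤ (PEA 2).no :=
  PEAInst.encoding.toLanguage_mono fun _ hI => ⟨hI.2.1, hI.2.2⟩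

/-- Textbook promise-BPP is antitone in the promise (same witness language, same coins).
[Goldreich2006, §1.2] (as in Disproof.lean §2) -/
theorem mem_PromiseBPP'_anti {Q Q' : PromiseProblem} (hy : Q.yes ≤ Q'.yes) (hn : Q.no ≤ Q'.no)
    (h : Q' ∈ PromiseBPP') : Q ∈ PromiseBPP' := by
  obtain ⟨L', hL', p, hyes, hno⟩ := h
  exact ⟨L', hL', p, fun x hx => hyes x (hy hx), fun x hx => hno x (hn hx)⟩

/-- The crux is literally `PEA 2 ∈ PromiseBPP'` (also `Summit.PneNP.PneNP.Theorems.szkEntropy_peaTwoMemBPP_iff`,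
LANDED Negative file). -/
theorem peaTwoMemBPP_iff : PeaTwoMemBPP ↔ PEA 2 ∈ PromiseBPP' := Iff.rfl

/-- **NECESSITY** (card, P1 `syndromeEA_of_pea2`): any proof of the crux puts every rate-restricted coding
rung in promise-BPP.  Contrapositive: hardness evidence for BSC(1/4) code equivocation in ANY regime is
evidence against `PeaTwoMemBPP` (and, by Disproof §3, for thesis X). -/
theorem syndromeEA_of_peaTwoMemBPP (R : ℕ → ℕ → Prop) (h : PeaTwoMemBPP) : SyndromeEA R ∈ PromiseBPP' :=
  mem_PromiseBPP'_anti (syndromeEA_yes_le R) (syndromeEA_no_le R) (peaTwoMemBPP_iff.1 h)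

/-! ### Registered stubs -/

/-- **stub_lift (K2 of the card, rank 3 there; "Transfer" direction): `PEA 2` Karp-reduces to the coding
rung.**  Informally: from a sparse quadratic map `q : F₂ⁿ → F₂ᵐ` and threshold `t`, compute in polynomial
time a parity-check matrix `G` and threshold `t'` with `H(q) ≥ t+1 ⇒ H(syndromeMap G) ≥ t'+1` and
`H(q) ≤ t ⇒ H(syndromeMap G) ≤ t'`.  Candidate mechanisms (none worked out — triage: "K2 has no mechanism,
conceded"): decoupling the Veronese source along the polarization identity `q(x+x') − q(x) − q(x') = B(x,x')`;
diagonalising pencil members; squaring (random affine input restriction, triage (γ)) + the `(U,E)`-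
linearisation of line polar-star as preprocessing.  Why plausibly true: it is implied by `PEA 2 ∈ PromiseP`
(a decider is a reduction to any problem with both sides inhabited), so it is strictly weaker than the
deterministic form of the crux and fails only if degree 2 carries entropy structure that codes cannot
express within a Karp reduction.  Why it might fail: decoupling changes entropy by `Θ(m)` in general (rank
structure of the Veronese source, e.g. `(x₁, x₁x_i)_i`, has no i.i.d. analogue).  Size XL.
Leans on: `PolyMapF2.entropy_prod`, `mapEntropy_comp_of_injOn`, `mapEntropy_univ_affine_zmod_two`, `FP`.
[idea card K2; DvirGutfreundRothblumVadhan2010 §5; TRIAGE-r1-2 (γ)] -/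
theorem stub_lift : (PEA 2).PolyTimeReducible (SyndromeEA (fun _ _ => True)) := by
  sorry

/-- **stub_census (card First lemma `entropy_syndromeMap_ge_census`; Shannon ≥ Rényi-2 = Parseval census):**
for every `G ∈ F₂^{k×N}`, `k − log₂ Σ_{λ ∈ F₂^k} 4^{−wt(λG)} ≤ H(syndromeMap G)`.  Proof sketch: the law of
`S = G(u ⊙ v)` is that of `G E`, `E ∼ Ber(1/4)^N`; `bias(λ·S) = (1 − 2·¼)^{wt(λG)} = 2^{−wt(λG)}`; Parseval
gives the collision probability `CP(S) = 2^{−k} Σ_λ bias(λ·S)²`, and `H ≥ H₂ = −log₂ CP` (Jensen).  This is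
the one-sided YES-certificate of the line (census used as a LOWER bound only — Disproof §4/§5 show it does
not determine `H`).  TRUE; size M in Lean (law of `u ⊙ v`, Walsh expansion over `F₂^k`, Jensen).
Leans on: `Literature.InformationTheory.Coding.carlet2020_prop55` (Walsh spectrum of `Σ u_j v_j`),
`sum_mul_log_div_le_chiSq` / `card_filter_div_card_le_of_mapEntropy` (entropy vs collision),
`mapEntropy_eq_sum_image`. [DvirGutfreundRothblumVadhan2010 Claim 5.6; idea card P1] -/
theorem stub_census : ∀ (k N : ℕ) (G : Matrix (Fin k) (Fin N) (ZMod 2)),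
    (k : ℝ) - Real.logb 2 (∑ l : Fin k → ZMod 2,
        (1 / 4 : ℝ) ^ (Finset.univ.filter fun j : Fin N => Matrix.vecMul l G j ≠ 0).card)
      ≤ (syndromeMap G).entropy := by
  sorry

/-- **stub_subcritical (K1 below criticality; resolvability side):** given the census certificate, for every
rational `r < h(1/4)` the rung restricted to check density `k/N ≤ r` is in promise-BPP.  Here `ker G` has
rate above BSC(1/4) capacity, the generic value is `H = k − o(1)` (the syndrome is near-uniform: channel
resolvability), and entropy is lost only through STRUCTURE: light words of `C = rowsp G` (bias `2^{−w}`,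
found by information-set decoding up to weight `c(r)·log N` in time `N^{O(c(r))}`), check-dense blocks `T`
(local density `> k/N`, exposed as words of `C` surviving the shortening `C ∩ F₂^S` at a random coordinate
set `S` of size `N − k`), and — triage-3 sharpening — aggregate weak-bias structure (an anomalously large
census `Σ_λ bias²` with every single bias `≤ N^{−1/2}`; informative below the Rényi-2 density
`log₂(8/5) ≈ 0.678`, where the generic census is `≈ 1` — family (Z)); after peeling/conditioning the found
structure the remainder
obeys the generic formula `F₂ = E_e min(k, log₂ 1/P(e))` (triage-2 correction of the card's formula) to
`±1/4`.  Equivalent (products stay in the regime) to an additive `poly(N,1/ε)` approximation scheme on this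
regime.  Why it might fail: the inverse theorem "no detectable structure at scale `c(r) log N` ⇒ formula" is
unproved for a FIXED code (the weight distribution is `#P`/`#BIS`-hard, GoldbergJerrum2013 Cor. 7), and
peeling weight-2 kernel words leaves the i.i.d. family (noise `Ber(p_j)`: the natural closed family is
syndromes of block-product sources; family (Z) = dense `Z₂`-synchronisation then needs the replica-symmetric
term instance-wise, TRIAGE-r1-3).  Size XL.  Leans on: `stub_census`, `PromiseProblem.mem_PromiseBPP'_of_fp_decider`,
`PromiseBPPAmplification*`, `Literature/InformationTheory/Coding/{DualDistance,GilbertVarshamovDual*,HammingBall}`,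
arXiv:0904.0308 (Hayashi, resolvability exponent), arXiv:2205.10552 (code smoothing), Prange1962/Stern1989 (ISD).
[idea card K1; TRIAGE-r1-2 sharpen (i)(ii); TRIAGE-r1-3 sharpen] -/
theorem stub_subcritical :
    (∀ (k N : ℕ) (G : Matrix (Fin k) (Fin N) (ZMod 2)),
      (k : ℝ) - Real.logb 2 (∑ l : Fin k → ZMod 2,
          (1 / 4 : ℝ) ^ (Finset.univ.filter fun j : Fin N => Matrix.vecMul l G j ≠ 0).card)
        ≤ (syndromeMap G).entropy) →
    ∀ r : ℚ, (r : ℝ) < hQuarter → SyndromeEA (fun k N => (k : ℚ) ≤ r * (N : ℚ)) ∈ PromiseBPP' := by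
  sorry

/-- **stub_supercritical (K1 above criticality; the `k/N > h(1/4)` branch triage-2 asked for = MAPDEC for
codes bounded away from capacity):** for every rational `r > h(1/4)` the rung restricted to check density
`k/N ≥ r` is in promise-BPP.  Here `H(syndromeMap G) = N·h(1/4) − eq(ker G)` with `ker G` of rate
`≤ 1 − r <` capacity; the generic value is `N·h(1/4) − 2^{−E(r−h(1/4))N}` and deviations come from
sub-structures of length `ℓ` contributing `≈ 2^{−E·ℓ}` each, hence entropy-relevant (at precision `ε`) only
up to `ℓ = O_r(log(N/ε))` — a scale at which light words (ISD), private-check blocks (shortening / matroid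
linking) are findable and the found blocks can be resolved by brute force `2^{O(ℓ)} = poly(N/ε)^{O(1/E)}`.
Why it might fail: pervasive visible sparse structure (LDPC/LDGM-type `G` with row weight `c log N`) leaves
a Bethe free energy with instance-wise loop corrections to pin to `±1/4` (card K1 "why it might fail";
arXiv:cs/0407060); the time exponent `~1/E(r − h(1/4))` blows up as `r ↓ h(1/4)`.  Size XL.
Leans on: `PromiseProblem.mem_PromiseBPP'_of_fp_decider`, ISD as in `stub_subcritical`, arXiv:1301.5676
(conditional entropy of sparse-graph codes), BLVW2019 (worst-case LPN / smoothing parameters).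
[idea card K1; TRIAGE-r1-2 sharpen (ii) and finding (β)] -/
theorem stub_supercritical :
    ∀ r : ℚ, hQuarter < (r : ℝ) → SyndromeEA (fun k N => r * (N : ℚ) ≤ (k : ℚ)) ∈ PromiseBPP' := by
  sorry

/-- **stub_critical (the critical window; HARDEST stub):** deciders at every fixed rational distance from the
critical density `h(1/4)` (below and above) yield a decider for the whole rung.  Content: a UNIFORM algorithm
across `k/N → h(1/4)`, where the generic deficiency is itself `Θ(√N)` (channel dispersion; formula `F₂`
covers it, TRIAGE-r1-1/2) and — finding F* of this crux-plan — hidden MESOSCOPIC structure becomes both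
entropy-relevant and scale-invisible: `b` disjoint near-critical random blocks of length `L = g·log N`
(local density `h(1/4) ± Δ(g)`, `E(Δ)·L ≈ ½·log₂ N`) shift `H` by `b·ε_L ≈ N^{1/2}` while `C ∪ K` has no
word lighter than `≈ 0.029·g·log N` and block density equals global density (all three card detectors
blind).  Weakly glued direct sums are still caught in polynomial time by matroid LINKING (Tutte linking
number via matroid intersection with `t+1` random seeds a side: planted `λ = t`, random `t+1`), but
critically glued blocks (or, simplest, plain direct powers, which lie in the rung) can only be RESOLVED by
computing the BSC(1/4) equivocation of worst-case codes of length `L` to precision `2^{−L/g}` in time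
`2^{O(L/g)}`, for `g → ∞` — no such algorithm is known (brute force / Walsh transform: `2^{0.81L}`).  So this
stub is where `PeaTwoMemBPP` most plausibly FAILS; by `syndromeEA_of_peaTwoMemBPP` its conclusion is
necessary for the crux, so a conditional refutation here (under a sub-exponential-precision hardness
hypothesis for short-code equivocation, or hidden-LDPC indistinguishability at row weight `ω(log N)`) is a
conditional refutation of the crux.  Size XL / open.  Leans on: the two regime stubs, closure of
`PromiseBPP'` under P-decidable case splits of the promise (routine: `uniformProb_take_of_le`,
`preimage_mem_P`), `PolyMapF2.entropy_prod`. [TRIAGE-r1-1 §X and py/critical.py; TRIAGE-r1-2 (β);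
PolyanskiyPoorVerdu2010 (dispersion); MisoczkiTillichSendrierBarreto2013 (MDPC indistinguishability)] -/
theorem stub_critical :
    (∀ r : ℚ, (r : ℝ) < hQuarter → SyndromeEA (fun k N => (k : ℚ) ≤ r * (N : ℚ)) ∈ PromiseBPP') →
    (∀ r : ℚ, hQuarter < (r : ℝ) → SyndromeEA (fun k N => r * (N : ℚ) ≤ (k : ℚ)) ∈ PromiseBPP') →
    SyndromeEA (fun _ _ => True) ∈ PromiseBPP' := by
  sorry

/-! ### Composition -/

/-- **The line concludes the crux by name.**  Dependency shape (the `have` chain below is exactly this arrow):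

  `stub_lift → stub_census → stub_subcritical → stub_supercritical → stub_critical → PeaTwoMemBPP`,

i.e. lift (K2) + census certificate + the two off-critical regime deciders + critical-window uniformity ⇒
`PeaTwoMemBPP`, via closure of promise-BPP under Karp reductions
(`PromiseProblem.mem_PromiseBPP'_of_polyTimeReducible_holds'`, Goldreich 2006 §1.2, PROVED in the tree) and
`PeaTwoMemBPP ↔ PEA 2 ∈ PromiseBPP'` (`Iff.rfl`).  This theorem contains no `sorry`; the only gaps of the file are
the five registered stubs it invokes (layer invariant `#h21_check_skeleton`). -/
theorem PeaTwoMemBPP_of : PeaTwoMemBPP :=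
  have hlift : (PEA 2).PolyTimeReducible (SyndromeEA (fun _ _ => True)) := stub_lift
  have hcensus : ∀ (k N : ℕ) (G : Matrix (Fin k) (Fin N) (ZMod 2)),
      (k : ℝ) - Real.logb 2 (∑ l : Fin k → ZMod 2,
          (1 / 4 : ℝ) ^ (Finset.univ.filter fun j : Fin N => Matrix.vecMul l G j ≠ 0).card)
        ≤ (syndromeMap G).entropy := stub_census
  have hsub : ∀ r : ℚ, (r : ℝ) < hQuarter →
      SyndromeEA (fun k N => (k : ℚ) ≤ r * (N : ℚ)) ∈ PromiseBPP' := stub_subcritical hcensus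
  have hsup : ∀ r : ℚ, hQuarter < (r : ℝ) →
      SyndromeEA (fun k N => r * (N : ℚ) ≤ (k : ℚ)) ∈ PromiseBPP' := stub_supercritical
  have hcrit : SyndromeEA (fun _ _ => True) ∈ PromiseBPP' := stub_critical hsub hsup
  peaTwoMemBPP_iff.2 (PromiseProblem.mem_PromiseBPP'_of_polyTimeReducible_holds' hlift hcrit)

end Summit.PneNP.PneNP.Cruxes.PeaTwoMemBPP.SyndromeEquivocation
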